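import Summits.QuantumFields.BalabanUV.T4Continuum.Support.DirichletCornerCutoutEta

/-!
# `BalabanUV.T4Continuum.Support.DirichletCornerCutoutCover` — NE2 (node U1a) formalisation swarm, sub-row `T4-U1a.S-NE2-D1-DIRICHLET°`, supplier item
# «Δ1-SKELETON» (file 10): THE CUT-OUT COVERS THE CORNERS — `etaC = 1` on the `2`-step neighbourhood of every `NearCorner β` set of every
# `−μ`-exposed block (`R′ ≥ 2R + 2`), hence the field `(1 − etaC)·v` satisfies the support hypothesis `hfar` of file 7's `psiS_relSmoothIn`
# for EVERY `v` (unit b2b-balaban-t4-ne2-formalise-leaf-08, gen 7, file 10)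

HONEST FRAMING.  Rung (B)+1 bookkeeping at MODEL level, finite torus; pure lattice combinatorics; NE2 (U1a) is NOT proved by this file;
spine PROVED 0/9 unchanged; NOT infinite volume, NOT the mass gap, NOT Clay.  HONEST DEPENDENCY (verbatim): «continuum YM on T⁴ ⇐ BetaPertH ∧
nine spine estimates (0/9 proved); BetaPertH ⇐ (D1) ∧ (D4) ∧ CAP+tail; G-an2-4 gates asym, D1 and NE2/3/4.»

WHAT THIS FILE PROVES (0 sorry).  §1 radius-`ρ` versions [shape] `NearPlaneR` ∕ `NearFaceR` ∕ `InWinR` of file 6's predicates and the bundle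
`NC ρ β κ₁ κ₂ x`; `NC_of_nearCorner` (file 6's `NearCorner` = radius `2R`); **`NC_add` ∕ `NC_sub`**: one lattice step along any axis costs
one unit of radius (`ρ + 2 ≤ n`).  §2 **`Cb_eq_one_of_NC`** (`ρ ≤ R′`: every axis profile sits on its plateau) and `etaC_eq_one_of_NC`.
(§3 — `hfar_of_etaC`, `psiS_relSmoothIn_cutout` — lives in the sequel file `DirichletCornerCutoutFar`.)

ABSOLUTE RULE (cell, verbatim): «No internally-minted statement may enter as a cited fact. Every hypothesis is either kernel-proved in
this package or a verbatim quotation of a PUBLISHED theorem with page reference. The manuscript(s) under audit are NOT citable for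
their own disputed steps — they are the thing under adjudication; programme-internal (2001/route/tribunal) claims are never citable.»
[folklore] lattice bookkeeping; [shape] predicates on data; no `def … : Prop` fact.  NOT CLAIMED: the two-level law; NE2; NE3.
-/

noncomputable section

open scoped BigOperators
open Finset

namespace Summit.QuantumFields.BalabanUV.T4Continuum.DirichletCornerCutoutCover

open Literature.MathematicalPhysics.QuantumFieldTheory.Balaban1983to89.B5Prop11Plancherel (Tor fine unitVec)
open Literature.MathematicalPhysics.QuantumFieldTheory.Balaban1983to89.B5Blocks16 (blockOf)
open Summit.QuantumFields.BalabanUV.Beta.GAN24.DirichletBoxTrace (blockReg)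
open Summit.QuantumFields.BalabanUV.T4Continuum.DirichletMonotoneCutoff (offsF blockOf_offsF_add_of_lt blockOf_offsF_add_of_eq blockOf_offsF_sub)
open Summit.QuantumFields.BalabanUV.T4Continuum.ScaleProfile (qprof qprof_eq_one qprof_eq_zero)
open Summit.QuantumFields.BalabanUV.T4Continuum.DirichletDirectionalBesovCutoff (cut)
open Summit.QuantumFields.BalabanUV.T4Continuum.DirichletDipCutoff (BotExp psiS)
open Summit.QuantumFields.BalabanUV.T4Continuum.DirichletDipCutoffAxis (liftA add_unitVec_self add_unitVec_ne sub_unitVec_self sub_unitVec_ne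
  one_ne_zero_of_botExp)
open Summit.QuantumFields.BalabanUV.T4Continuum.DirichletDipCutoffCorner (NearPlane NearFace NearCorner)
open Summit.QuantumFields.BalabanUV.T4Continuum.DirichletDipCutoffSmooth (psiS_relSmoothIn ell1 ell2)
open Summit.QuantumFields.BalabanUV.T4Continuum.DirichletCornerCutout (Hp Dp Ep)
open Summit.QuantumFields.BalabanUV.T4Continuum.DirichletCornerCutoutEta (cfac Cb CornerIdx etaC Cb_eq_one_of etaC_eq_one_of_Cb)
open Summit.QuantumFields.BalabanUV.T4Continuum.DirichletRelativeBesovIntrinsic (RelSmoothIn)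

variable {d : ℕ} (n : ℕ) [NeZero n] (M : Fin d → ℕ) [hM : ∀ μ, NeZero (M μ)] (μ : Fin d)

/-! ## §1 Radius-`ρ` corner predicates and their stability under one lattice step -/

/-- [shape] within `ρ` of the bottom plane of `β` (from above inside the layer of `β`, from below inside the layer under it). [folklore] -/
def NearPlaneR (ρ : ℕ) (β : Tor M) (x : Tor (fine n M)) : Prop :=
  (blockOf n M x μ = β μ ∧ (offsF n M x μ : ℕ) ≤ ρ) ∨ (blockOf n M x μ = β μ - 1 ∧ n - 1 - (offsF n M x μ : ℕ) ≤ ρ)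

/-- [shape] within `ρ` of one of the two `κ`-face planes of the range of `β`. [folklore] -/
def NearFaceR (ρ : ℕ) (β : Tor M) (κ : Fin d) (x : Tor (fine n M)) : Prop :=
  (blockOf n M x κ = β κ ∧ ((offsF n M x κ : ℕ) ≤ ρ ∨ n - 1 - (offsF n M x κ : ℕ) ≤ ρ))
    ∨ (blockOf n M x κ = β κ + 1 ∧ (offsF n M x κ : ℕ) ≤ ρ) ∨ (blockOf n M x κ = β κ - 1 ∧ n - 1 - (offsF n M x κ : ℕ) ≤ ρ)

/-- [shape] inside the range of `β` along `κ`, or within `ρ` of it. [folklore] -/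
def InWinR (ρ : ℕ) (β : Tor M) (κ : Fin d) (x : Tor (fine n M)) : Prop := blockOf n M x κ = β κ ∨ NearFaceR n M ρ β κ x

/-- [shape] the radius-`ρ` corner bundle for the transversal pair `(κ₁, κ₂)`. [folklore] -/
def NC (ρ : ℕ) (β : Tor M) (κ₁ κ₂ : Fin d) (x : Tor (fine n M)) : Prop :=
  NearPlaneR n M μ ρ β x ∧ NearFaceR n M ρ β κ₁ x ∧ NearFaceR n M ρ β κ₂ x ∧ ∀ lam, lam ≠ μ → InWinR n M ρ β lam x

section Shift

variable {n M μ}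

/-- file 6's `NearCorner` (radius `2R`) gives the bundle `NC (2R)` for its witnessing pair. [folklore] -/
theorem NC_of_nearCorner {R : ℕ} {β : Tor M} {x : Tor (fine n M)} (h : NearCorner n M μ R β x) :
    ∃ κ₁ κ₂, κ₁ ≠ μ ∧ κ₂ ≠ μ ∧ κ₁ ≠ κ₂ ∧ NC n M μ (2 * R) β κ₁ κ₂ x := by
  obtain ⟨hp, ⟨κ₁, κ₂, h1, h2, h12, hf1, hf2⟩, hw⟩ := h
  have convF : ∀ κ, NearFace n M R β κ x → NearFaceR n M (2 * R) β κ x := fun κ hF => by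
    have ht := (offsF n M x κ).isLt
    rcases hF with ⟨hb, hc⟩ | ⟨hb, hc⟩ | ⟨hb, hc⟩
    · exact Or.inl ⟨hb, hc.imp id (fun h => by omega)⟩
    · exact Or.inr (Or.inl ⟨hb, hc⟩)
    · exact Or.inr (Or.inr ⟨hb, by omega⟩)
  refine ⟨κ₁, κ₂, h1, h2, h12, ?_, convF κ₁ hf1, convF κ₂ hf2, fun lam hl => (hw lam hl).imp id (convF lam)⟩
  have ht := (offsF n M x μ).isLt
  rcases hp with ⟨hb, hc⟩ | ⟨hb, hc⟩
  · exact Or.inl ⟨hb, hc⟩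
  · exact Or.inr ⟨hb, by omega⟩

/-- `NearFaceR` along its own axis: one step forward costs one unit of radius. [folklore] -/
theorem nearFaceR_add_self {ρ : ℕ} (hρ : ρ + 2 ≤ n) {β : Tor M} {κ : Fin d} {x : Tor (fine n M)} (h : NearFaceR n M ρ β κ x) :
    NearFaceR n M (ρ + 1) β κ (x + unitVec (fine n M) κ) := by
  unfold NearFaceR at *
  rcases Nat.lt_or_ge ((offsF n M x κ : ℕ) + 1) n with hlt | hge
  · obtain ⟨hb, ho⟩ := blockOf_offsF_add_of_lt n M x κ hlt
    rw [hb, ho, Function.update_self]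
    show (_ ∧ ((offsF n M x κ : ℕ) + 1 ≤ ρ + 1 ∨ n - 1 - ((offsF n M x κ : ℕ) + 1) ≤ ρ + 1))
      ∨ (_ ∧ (offsF n M x κ : ℕ) + 1 ≤ ρ + 1) ∨ (_ ∧ n - 1 - ((offsF n M x κ : ℕ) + 1) ≤ ρ + 1)
    rcases h with ⟨hb', hc⟩ | ⟨hb', hc⟩ | ⟨hb', hc⟩
    · exact Or.inl ⟨hb', by omega⟩
    · exact Or.inr (Or.inl ⟨hb', by omega⟩)
    · exact Or.inr (Or.inr ⟨hb', by omega⟩)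
  · have heq : (offsF n M x κ : ℕ) + 1 = n := le_antisymm (offsF n M x κ).isLt hge
    obtain ⟨hb, ho⟩ := blockOf_offsF_add_of_eq n M x κ heq
    rw [hb, ho, Function.update_self, Fin.val_zero, add_unitVec_self]
    rcases h with ⟨hb', hc⟩ | ⟨hb', hc⟩ | ⟨hb', hc⟩
    · exact Or.inr (Or.inl ⟨by rw [hb'], Nat.zero_le _⟩)
    · omega
    · exact Or.inl ⟨by rw [hb', sub_add_cancel], Or.inl (Nat.zero_le _)⟩

/-- … one step backward costs one unit of radius. [folklore] -/
theorem nearFaceR_sub_self {ρ : ℕ} (hρ : ρ + 2 ≤ n) {β : Tor M} {κ : Fin d} {x : Tor (fine n M)} (h : NearFaceR n M ρ β κ x) :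
    NearFaceR n M (ρ + 1) β κ (x - unitVec (fine n M) κ) := by
  unfold NearFaceR at *
  rcases blockOf_offsF_sub n M x κ with ⟨hne, hb, ho, -⟩ | ⟨h0, hb, ho, -⟩
  · rw [hb, ho]
    have ht := (offsF n M x κ).isLt
    rcases h with ⟨hb', hc⟩ | ⟨hb', hc⟩ | ⟨hb', hc⟩
    · exact Or.inl ⟨hb', by omega⟩
    · exact Or.inr (Or.inl ⟨hb', by omega⟩)
    · exact Or.inr (Or.inr ⟨hb', by omega⟩)
  · rw [hb, ho, sub_unitVec_self]
    rcases h with ⟨hb', hc⟩ | ⟨hb', hc⟩ | ⟨hb', hc⟩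
    · exact Or.inr (Or.inr ⟨by rw [hb'], by omega⟩)
    · exact Or.inl ⟨by rw [hb', add_sub_cancel_right], Or.inr (by omega)⟩
    · omega

/-- `NearFaceR` is unchanged by steps along other axes (forward). [folklore] -/
theorem nearFaceR_add_ne {ρ : ℕ} {β : Tor M} {κ ν : Fin d} (hν : ν ≠ κ) {x : Tor (fine n M)} (h : NearFaceR n M ρ β κ x) :
    NearFaceR n M ρ β κ (x + unitVec (fine n M) ν) := by
  unfold NearFaceR at *
  rcases Nat.lt_or_ge ((offsF n M x ν : ℕ) + 1) n with hlt | hge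
  · obtain ⟨hb, ho⟩ := blockOf_offsF_add_of_lt n M x ν hlt
    rw [hb, ho, Function.update_of_ne (Ne.symm hν)]; exact h
  · have heq : (offsF n M x ν : ℕ) + 1 = n := le_antisymm (offsF n M x ν).isLt hge
    obtain ⟨hb, ho⟩ := blockOf_offsF_add_of_eq n M x ν heq
    rw [hb, ho, Function.update_of_ne (Ne.symm hν), add_unitVec_ne M _ (Ne.symm hν)]; exact h

/-- … (backward). [folklore] -/
theorem nearFaceR_sub_ne {ρ : ℕ} {β : Tor M} {κ ν : Fin d} (hν : ν ≠ κ) {x : Tor (fine n M)} (h : NearFaceR n M ρ β κ x) :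
    NearFaceR n M ρ β κ (x - unitVec (fine n M) ν) := by
  unfold NearFaceR at *
  rcases blockOf_offsF_sub n M x ν with ⟨-, hb, -, ho⟩ | ⟨-, hb, -, ho⟩
  · rw [hb, ho κ (Ne.symm hν)]; exact h
  · rw [hb, ho κ (Ne.symm hν), sub_unitVec_ne M _ (Ne.symm hν)]; exact h

/-- radius monotonicity. [folklore] -/
theorem nearFaceR_mono {ρ ρ' : ℕ} (hρ : ρ ≤ ρ') {β : Tor M} {κ : Fin d} {x : Tor (fine n M)} (h : NearFaceR n M ρ β κ x) :
    NearFaceR n M ρ' β κ x := by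
  rcases h with ⟨hb, hc⟩ | ⟨hb, hc⟩ | ⟨hb, hc⟩
  · exact Or.inl ⟨hb, hc.imp (fun h => h.trans hρ) (fun h => h.trans hρ)⟩
  · exact Or.inr (Or.inl ⟨hb, hc.trans hρ⟩)
  · exact Or.inr (Or.inr ⟨hb, hc.trans hρ⟩)

/-- **`NearFaceR` under one step along any axis** (forward). [folklore] -/
theorem nearFaceR_add {ρ : ℕ} (hρ : ρ + 2 ≤ n) {β : Tor M} {κ : Fin d} (ν : Fin d) {x : Tor (fine n M)} (h : NearFaceR n M ρ β κ x) :
    NearFaceR n M (ρ + 1) β κ (x + unitVec (fine n M) ν) := by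
  by_cases hν : ν = κ
  · subst hν; exact nearFaceR_add_self hρ h
  · exact nearFaceR_mono (Nat.le_succ ρ) (nearFaceR_add_ne hν h)

/-- … (backward). [folklore] -/
theorem nearFaceR_sub {ρ : ℕ} (hρ : ρ + 2 ≤ n) {β : Tor M} {κ : Fin d} (ν : Fin d) {x : Tor (fine n M)} (h : NearFaceR n M ρ β κ x) :
    NearFaceR n M (ρ + 1) β κ (x - unitVec (fine n M) ν) := by
  by_cases hν : ν = κ
  · subst hν; exact nearFaceR_sub_self hρ h
  · exact nearFaceR_mono (Nat.le_succ ρ) (nearFaceR_sub_ne hν h)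

/-- **`InWinR` under one step along any axis** (forward). [folklore] -/
theorem inWinR_add {ρ : ℕ} (hρ : ρ + 2 ≤ n) {β : Tor M} {κ : Fin d} (ν : Fin d) {x : Tor (fine n M)} (h : InWinR n M ρ β κ x) :
    InWinR n M (ρ + 1) β κ (x + unitVec (fine n M) ν) := by
  rcases h with hb | hF
  · by_cases hν : ν = κ
    · subst hν
      rcases Nat.lt_or_ge ((offsF n M x ν : ℕ) + 1) n with hlt | hge
      · obtain ⟨hb', -⟩ := blockOf_offsF_add_of_lt n M x ν hlt
        exact Or.inl (by rw [hb']; exact hb)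
      · have heq : (offsF n M x ν : ℕ) + 1 = n := le_antisymm (offsF n M x ν).isLt hge
        obtain ⟨hb', ho⟩ := blockOf_offsF_add_of_eq n M x ν heq
        right; unfold NearFaceR
        rw [hb', ho, Function.update_self, Fin.val_zero, add_unitVec_self, hb]
        exact Or.inr (Or.inl ⟨rfl, Nat.zero_le _⟩)
    · rcases Nat.lt_or_ge ((offsF n M x ν : ℕ) + 1) n with hlt | hge
      · obtain ⟨hb', -⟩ := blockOf_offsF_add_of_lt n M x ν hlt
        exact Or.inl (by rw [hb']; exact hb)
      · have heq : (offsF n M x ν : ℕ) + 1 = n := le_antisymm (offsF n M x ν).isLt hge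
        obtain ⟨hb', -⟩ := blockOf_offsF_add_of_eq n M x ν heq
        exact Or.inl (by rw [hb', add_unitVec_ne M _ (Ne.symm hν)]; exact hb)
  · exact Or.inr (nearFaceR_add hρ ν hF)

/-- … (backward). [folklore] -/
theorem inWinR_sub {ρ : ℕ} (hρ : ρ + 2 ≤ n) {β : Tor M} {κ : Fin d} (ν : Fin d) {x : Tor (fine n M)} (h : InWinR n M ρ β κ x) :
    InWinR n M (ρ + 1) β κ (x - unitVec (fine n M) ν) := by
  rcases h with hb | hF
  · by_cases hν : ν = κ
    · subst hν
      rcases blockOf_offsF_sub n M x ν with ⟨-, hb', -, -⟩ | ⟨-, hb', ho, -⟩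
      · exact Or.inl (by rw [hb']; exact hb)
      · right; unfold NearFaceR
        rw [hb', ho, sub_unitVec_self, hb]
        exact Or.inr (Or.inr ⟨rfl, by omega⟩)
    · rcases blockOf_offsF_sub n M x ν with ⟨-, hb', -, -⟩ | ⟨-, hb', -, -⟩
      · exact Or.inl (by rw [hb']; exact hb)
      · exact Or.inl (by rw [hb', sub_unitVec_ne M _ (Ne.symm hν)]; exact hb)
  · exact Or.inr (nearFaceR_sub hρ ν hF)

/-- `NearPlaneR` is `NearFaceR` along `μ` restricted to the bottom plane; one step along any axis (forward). [folklore] -/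
theorem nearPlaneR_add {ρ : ℕ} (hρ : ρ + 2 ≤ n) {β : Tor M} (ν : Fin d) {x : Tor (fine n M)} (h : NearPlaneR n M μ ρ β x) :
    NearPlaneR n M μ (ρ + 1) β (x + unitVec (fine n M) ν) := by
  unfold NearPlaneR at *
  rcases Nat.lt_or_ge ((offsF n M x ν : ℕ) + 1) n with hlt | hge
  · obtain ⟨hb, ho⟩ := blockOf_offsF_add_of_lt n M x ν hlt
    rw [hb, ho]
    by_cases hν : ν = μ
    · subst hν; rw [Function.update_self]
      show (_ ∧ (offsF n M x ν : ℕ) + 1 ≤ ρ + 1) ∨ (_ ∧ n - 1 - ((offsF n M x ν : ℕ) + 1) ≤ ρ + 1)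
      rcases h with ⟨hb', hc⟩ | ⟨hb', hc⟩
      · exact Or.inl ⟨hb', by omega⟩
      · exact Or.inr ⟨hb', by omega⟩
    · rw [Function.update_of_ne (Ne.symm hν)]
      rcases h with ⟨hb', hc⟩ | ⟨hb', hc⟩
      · exact Or.inl ⟨hb', by omega⟩
      · exact Or.inr ⟨hb', by omega⟩
  · have heq : (offsF n M x ν : ℕ) + 1 = n := le_antisymm (offsF n M x ν).isLt hge
    obtain ⟨hb, ho⟩ := blockOf_offsF_add_of_eq n M x ν heq
    rw [hb, ho]
    by_cases hν : ν = μ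
    · subst hν; rw [Function.update_self, Fin.val_zero, add_unitVec_self]
      rcases h with ⟨hb', hc⟩ | ⟨hb', hc⟩
      · omega
      · exact Or.inl ⟨by rw [hb', sub_add_cancel], Nat.zero_le _⟩
    · rw [Function.update_of_ne (Ne.symm hν), add_unitVec_ne M _ (Ne.symm hν)]
      rcases h with ⟨hb', hc⟩ | ⟨hb', hc⟩
      · exact Or.inl ⟨hb', by omega⟩
      · exact Or.inr ⟨hb', by omega⟩

/-- … (backward). [folklore] -/
theorem nearPlaneR_sub {ρ : ℕ} (hρ : ρ + 2 ≤ n) {β : Tor M} (ν : Fin d) {x : Tor (fine n M)} (h : NearPlaneR n M μ ρ β x) :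
    NearPlaneR n M μ (ρ + 1) β (x - unitVec (fine n M) ν) := by
  unfold NearPlaneR at *
  have ht := (offsF n M x μ).isLt
  rcases blockOf_offsF_sub n M x ν with ⟨hne, hb, ho, ho'⟩ | ⟨h0, hb, ho, ho'⟩
  · rw [hb]
    by_cases hν : ν = μ
    · subst hν; rw [ho]
      rcases h with ⟨hb', hc⟩ | ⟨hb', hc⟩
      · exact Or.inl ⟨hb', by omega⟩
      · exact Or.inr ⟨hb', by omega⟩
    · rw [ho' μ (Ne.symm hν)]
      rcases h with ⟨hb', hc⟩ | ⟨hb', hc⟩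
      · exact Or.inl ⟨hb', by omega⟩
      · exact Or.inr ⟨hb', by omega⟩
  · rw [hb]
    by_cases hν : ν = μ
    · subst hν; rw [ho, sub_unitVec_self]
      rcases h with ⟨hb', hc⟩ | ⟨hb', hc⟩
      · exact Or.inr ⟨by rw [hb'], by omega⟩
      · omega
    · rw [ho' μ (Ne.symm hν), sub_unitVec_ne M _ (Ne.symm hν)]
      rcases h with ⟨hb', hc⟩ | ⟨hb', hc⟩
      · exact Or.inl ⟨hb', by omega⟩
      · exact Or.inr ⟨hb', by omega⟩

/-- **the corner bundle under one lattice step** (forward). [folklore] -/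
theorem NC_add {ρ : ℕ} (hρ : ρ + 2 ≤ n) {β : Tor M} {κ₁ κ₂ : Fin d} (ν : Fin d) {x : Tor (fine n M)} (h : NC n M μ ρ β κ₁ κ₂ x) :
    NC n M μ (ρ + 1) β κ₁ κ₂ (x + unitVec (fine n M) ν) :=
  ⟨nearPlaneR_add hρ ν h.1, nearFaceR_add hρ ν h.2.1, nearFaceR_add hρ ν h.2.2.1, fun lam hl => inWinR_add hρ ν (h.2.2.2 lam hl)⟩

/-- … (backward). [folklore] -/
theorem NC_sub {ρ : ℕ} (hρ : ρ + 2 ≤ n) {β : Tor M} {κ₁ κ₂ : Fin d} (ν : Fin d) {x : Tor (fine n M)} (h : NC n M μ ρ β κ₁ κ₂ x) :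
    NC n M μ (ρ + 1) β κ₁ κ₂ (x - unitVec (fine n M) ν) :=
  ⟨nearPlaneR_sub hρ ν h.1, nearFaceR_sub hρ ν h.2.1, nearFaceR_sub hρ ν h.2.2.1, fun lam hl => inWinR_sub hρ ν (h.2.2.2 lam hl)⟩

end Shift

/-! ## §2 On the corner bundle every axis profile sits on its plateau -/

section Plateau

variable {n M μ} {S : Tor M → Prop} [DecidablePred S] {R R' : ℕ} (hR : 2 ≤ R) (hn : 2 * (R' + R) ≤ n)
include hR hn

omit [NeZero n] in
/-- plateau ∕ far values used below: `q′ i = 1` for `i ≤ R′`, `q′ (n − 1 − i) = 0` for `i ≤ R′`. [folklore] -/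
theorem q_plateau {i : ℕ} (hi : i ≤ R') : qprof R R' i = 1 ∧ qprof R R' (n - 1 - i) = 0 :=
  ⟨qprof_eq_one R' (by omega) hi, qprof_eq_zero hR R' (by omega)⟩

omit [DecidablePred S] in
/-- **`Cb = 1` on the radius-`ρ` bundle** (`ρ ≤ R′`). [folklore] -/
theorem Cb_eq_one_of_NC {ρ : ℕ} (hρ : ρ ≤ R') {β : Tor M} {κ₁ κ₂ : Fin d} (hidx : CornerIdx M S μ β κ₁ κ₂) {x : Tor (fine n M)}
    (h : NC n M μ ρ β κ₁ κ₂ x) : Cb n M μ R R' β κ₁ κ₂ x = 1 := by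
  obtain ⟨hp, hf1, hf2, hw⟩ := h
  have h10 := one_ne_zero_of_botExp hidx.1
  have hμμ : β μ - 1 ≠ β μ := fun h => h10 (by have := congrArg (fun z => β μ - z) h; simpa using this)
  -- value of a two-sided ∕ collar profile on a `NearFaceR` site
  have faceD : ∀ κ, NearFaceR n M ρ β κ x → Dp (n := n) R R' (β κ) (blockOf n M x κ) (offsF n M x κ : ℕ) = 1 := by
    intro κ hF
    have ht := (offsF n M x κ).isLt
    unfold Dp
    rcases hF with ⟨hb, hc⟩ | ⟨hb, hc⟩ | ⟨hb, hc⟩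
    · rw [if_pos hb]
      rcases hc with hc | hc
      · obtain ⟨a, b⟩ := q_plateau hR hn (hc.trans hρ); rw [a, b]; ring
      · obtain ⟨a, b⟩ := q_plateau hR hn (hc.trans hρ)
        rw [show n - 1 - (n - 1 - (offsF n M x κ : ℕ)) = (offsF n M x κ : ℕ) by omega] at b; rw [a, b]; ring
    · obtain ⟨a, b⟩ := q_plateau hR hn (hc.trans hρ)
      by_cases h0 : blockOf n M x κ = β κ
      · rw [if_pos h0, a, b]; ring
      · rw [if_neg h0, if_pos hb, a]; split_ifs <;> simp [b]
    · obtain ⟨a, b⟩ := q_plateau hR hn (hc.trans hρ)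
      rw [show n - 1 - (n - 1 - (offsF n M x κ : ℕ)) = (offsF n M x κ : ℕ) by omega] at b
      by_cases h0 : blockOf n M x κ = β κ
      · rw [if_pos h0, a, b]; ring
      · rw [if_neg h0, if_pos hb, a]; split_ifs <;> simp [b]
  have faceE : ∀ κ, InWinR n M ρ β κ x → Ep (n := n) R R' (β κ) (blockOf n M x κ) (offsF n M x κ : ℕ) = 1 := by
    intro κ hW
    unfold Ep
    by_cases h0 : blockOf n M x κ = β κ
    · rw [if_pos h0]
    · rw [if_neg h0]
      rcases hW with hb | hF
      · exact absurd hb h0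
      · rcases hF with ⟨hb, _⟩ | ⟨hb, hc⟩ | ⟨hb, hc⟩
        · exact absurd hb h0
        · obtain ⟨a, b⟩ := q_plateau hR hn (hc.trans hρ); rw [if_pos hb, a]; split_ifs <;> simp [b]
        · obtain ⟨a, b⟩ := q_plateau hR hn (hc.trans hρ)
          rw [show n - 1 - (n - 1 - (offsF n M x κ : ℕ)) = (offsF n M x κ : ℕ) by omega] at b
          rw [if_pos hb, a]; split_ifs <;> simp [b]
  refine Cb_eq_one_of fun lam => ?_
  unfold cfac liftA
  by_cases h1 : lam = μ
  · rw [if_pos h1]; subst h1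
    unfold Hp
    rcases hp with ⟨hb, hc⟩ | ⟨hb, hc⟩
    · rw [if_pos hb]; exact (q_plateau hR hn (hc.trans hρ)).1
    · rw [if_neg (by rw [hb]; exact hμμ), if_pos hb]; exact (q_plateau hR hn (hc.trans hρ)).1
  · rw [if_neg h1]
    by_cases h2 : lam = κ₁ ∨ lam = κ₂
    · rw [if_pos h2]
      rcases h2 with h2 | h2
      · subst h2; exact faceD _ hf1
      · subst h2; exact faceD _ hf2
    · rw [if_neg h2]; exact faceE lam (hw lam h1)

/-- hence `etaC = 1` there. [folklore] -/
theorem etaC_eq_one_of_NC {ρ : ℕ} (hρ : ρ ≤ R') {β : Tor M} {κ₁ κ₂ : Fin d} (hidx : CornerIdx M S μ β κ₁ κ₂) {x : Tor (fine n M)}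
    (h : NC n M μ ρ β κ₁ κ₂ x) : etaC n M S μ R R' x = 1 :=
  etaC_eq_one_of_Cb hidx (Cb_eq_one_of_NC hR hn hρ hidx h)

end Plateau

end Summit.QuantumFields.BalabanUV.T4Continuum.DirichletCornerCutoutCover

end
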